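import Literature.AlgebraicGeometry.HodgeTheory.HypersurfaceLefschetz
import Literature.AlgebraicGeometry.HodgeTheory.HypersurfaceLefschetzProofs
import Literature.AlgebraicGeometry.HodgeTheory.HardLefschetzNFold
import HarnessLib

/-!
# Lefschetz for smooth hypersurfaces (proof file, II): the degrees above the middle from those below

Sibling proof file of `Literature/AlgebraicGeometry/HodgeTheory/HypersurfaceLefschetz.lean` (named
fact `Voisin2003_smoothHypersurface_algebraicClasses_eq_top`: for a smooth hypersurface
`Y ⊂ ℙ^{n+1}_ℂ` and `0 < p < n`, `2p ≠ n`, `algebraicClasses Y p = ⊤`). In print (C. Voisin,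
*Hodge Theory and Complex Algebraic Geometry II*, §1.2.3) the range `2p < n` is Cor. 1.24 (the
Lefschetz theorem on hyperplane sections, Thm. 1.23) and the range `n < 2p < 2n` is Cor. 1.25
("If moreover `X` is smooth, then the next result follows from Poincaré duality"). This file
PROVES the standard alternative passage from the lower range to the upper one through **hard
Lefschetz** (Voisin I Thm. 6.25 with Rem. 6.27: `L^{2p-n} : H^{2n-2p}(Y) → H^{2p}(Y)` is an
isomorphism, and `L = [H] ∪ ·` maps `Nˡ H²ˡ` into `N^{l+1} H^{2l+2}`, Voisin II Prop. 9.20), on the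
tree's hypothesis structure `HardLefschetzNFold n Y` / named fact `nonempty_hardLefschetzNFold`
(file `HardLefschetzNFold`, whose `mem_algebraicClasses_of_lt` is the same remark for rational
Hodge classes):

* `HardLefschetzNFold.algebraicClasses_eq_top_of_eq_top`: for `2l + j = n`, if
  `algebraicClasses X l = ⊤` then `algebraicClasses X (l + j) = ⊤`;
* `HardLefschetzNFold.algebraicClasses_eq_top_of_lt`: for `n < 2p ≤ 2n`, if
  `algebraicClasses X (n - p) = ⊤` then `algebraicClasses X p = ⊤`;
* `Voisin2003_smoothHypersurface_algebraicClasses_eq_top_of_lower`: granted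
  `nonempty_hardLefschetzNFold` for smooth projective complex varieties, the named fact follows from
  its LOWER HALF (`0 < p`, `2p < n`) — which in turn is exactly the surjectivity of
  `ι^* : H²ᵖ(ℙ^{n+1}(ℂ); ℂ) → H²ᵖ(Y(ℂ); ℂ)` below the middle degree (Thm. 1.23), by
  `algebraicClasses_eq_top_of_surjective_map` of the sibling file `HypersurfaceLefschetzProofs`;
* `Voisin2003_smoothHypersurface_algebraicClasses_eq_top_of_surjective_map`: the two combined —
  granted hard Lefschetz, the named fact follows from the surjectivity, for every smooth hypersurface
  `Y` and every `0 < p`, `2p < dim Y`, of `ι^*` in degree `2p` for SOME morphism `ι : Y → ℙᴺ_ℂ`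
  (Voisin II Thm. 1.23 / Cor. 1.24 give it for the defining embedding `Y ⊂ ℙ^{n+1}`). This is the
  exact residual input for `Voisin2003_smoothHypersurface_algebraicClasses_eq_top_holds`.

Nothing is asserted: all statements are proved implications; the named facts enter as explicit
hypotheses.

## References

* [VoisinHodgeII2003] C. Voisin, Hodge Theory and Complex Algebraic Geometry II (CUP 2003), §1.2.3
  Cor. 1.24–1.25 (PDF p. 62), §9.2.4 Prop. 9.20.
* [VoisinHodgeI2002] C. Voisin, Hodge Theory and Complex Algebraic Geometry I (CUP 2002), §6.2.3
  Thm. 6.25, Rem. 6.27.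
-/

noncomputable section

namespace Literature.AlgebraicGeometry.HodgeTheory

section HodgeTheory

open Literature.AlgebraicGeometry.Motives

variable {n : ℕ} {X : Motives.SchemeOver ℂ}

namespace HardLefschetzNFold

/-- **If all of `H²ˡ(X(ℂ); ℂ)` is algebraic, so is all of `H^{2(l+j)}(X(ℂ); ℂ)`, for `2l + j = n`**:
`Lʲ : H²ˡ → H^{2n-2l}` is onto (hard Lefschetz, Voisin I Thm. 6.25) and maps `Nˡ H²ˡ` into
`N^{l+j} H^{2(l+j)}` (`[Z] ↦ [Hʲ · Z]`, Voisin II Prop. 9.20; the structure's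
`L_mem_algebraicClasses_of_mem`). [cite: VoisinHodgeI2002, §6.2.3 Thm. 6.25 and Rem. 6.27] -/
theorem algebraicClasses_eq_top_of_eq_top (Λ : HardLefschetzNFold n X) {l j : ℕ}
    (hjk : 2 * l + j = n) (h : algebraicClasses X l = ⊤) : algebraicClasses X (l + j) = ⊤ := by
  refine eq_top_iff.2 fun c _ ↦ ?_
  obtain ⟨c', rfl⟩ := (Λ.bijective_L hjk (2 * (l + j)) (by omega)).2 c
  exact Λ.L_mem_algebraicClasses_of_mem j l (by omega) (h ▸ Submodule.mem_top)

/-- **Above the middle from below the middle** (`= ⊤` form): on an `n`-fold with the hard Lefschetz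
datum, for `n < 2p ≤ 2n`, if every class of `H^{2n-2p}(X(ℂ); ℂ)` is algebraic then so is every
class of `H²ᵖ(X(ℂ); ℂ)` (`L^{2p-n} : H^{2n-2p} ≅ H^{2p}` preserves algebraicity).
[cite: VoisinHodgeI2002, §6.2.3 Thm. 6.25 and Rem. 6.27] -/
theorem algebraicClasses_eq_top_of_lt (Λ : HardLefschetzNFold n X) {p : ℕ} (hnp : n < 2 * p)
    (hpn : p ≤ n) (h : algebraicClasses X (n - p) = ⊤) : algebraicClasses X p = ⊤ := by
  have key : ∀ l j : ℕ, l + j = p → 2 * l + j = n → algebraicClasses X l = ⊤ →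
      algebraicClasses X p = ⊤ := by
    rintro l j rfl hjk hl
    exact Λ.algebraicClasses_eq_top_of_eq_top hjk hl
  exact key (n - p) (2 * p - n) (by omega) (by omega) h

end HardLefschetzNFold

/-- **The named fact from its lower half, granted hard Lefschetz.** If smooth projective complex
varieties carry the hard Lefschetz datum (`nonempty_hardLefschetzNFold`, Voisin I Thm. 6.25 /
Rem. 6.27 with Voisin II Prop. 9.20) and every smooth hypersurface `Y ⊂ ℙ^{n+1}_ℂ` has
`algebraicClasses Y p = ⊤` for `0 < p`, `2p < n` (Voisin II Cor. 1.24: `H²ᵖ(Y, ℤ) = ℤhᵖ`), then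
`Voisin2003_smoothHypersurface_algebraicClasses_eq_top` holds: for `n < 2p < 2n` apply
`HardLefschetzNFold.algebraicClasses_eq_top_of_lt` with `0 < n - p`, `2(n - p) < n` (this replaces
the Poincaré-duality argument of Cor. 1.25). [cite: VoisinHodgeII2003, §1.2.3 Cor. 1.24–1.25 (PDF p. 62)] -/
theorem Voisin2003_smoothHypersurface_algebraicClasses_eq_top_of_lower
    (hHL : ∀ ⦃m : ℕ⦄ ⦃Y : Motives.SchemeOver ℂ⦄, nonempty_hardLefschetzNFold m Y)
    (hlow : ∀ ⦃m d : ℕ⦄ ⦃Y : Motives.SchemeOver ℂ⦄, IsSmoothHypersurface m d Y →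
      ∀ p : ℕ, 0 < p → 2 * p < m → algebraicClasses Y p = ⊤) :
    Voisin2003_smoothHypersurface_algebraicClasses_eq_top := by
  intro m d Y hY p hp0 hpm h2
  rcases Nat.lt_or_gt_of_ne h2 with hlt | hgt
  · exact hlow hY p hp0 hlt
  · obtain ⟨Λ⟩ := hHL hY.1
    exact Λ.algebraicClasses_eq_top_of_lt hgt hpm.le (hlow hY (m - p) (by omega) (by omega))

/-- **The named fact from hard Lefschetz and Lefschetz surjectivity below the middle degree.** If
smooth projective complex varieties carry the hard Lefschetz datum (`nonempty_hardLefschetzNFold`)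
and, for every smooth hypersurface `Y` of dimension `m` and every `0 < p` with `2p < m`, SOME
morphism `ι : Y → ℙᴺ_ℂ` induces a surjection `ι^* : H²ᵖ(ℙᴺ(ℂ); ℂ) → H²ᵖ(Y(ℂ); ℂ)` — for the
defining embedding `Y ⊂ ℙ^{m+1}` this is the Lefschetz theorem on hyperplane sections, Voisin II
Thm. 1.23 through the Veronese embedding, i.e. Cor. 1.24 `H²ᵖ(Y, ℤ) = ℤhᵖ` — then
`Voisin2003_smoothHypersurface_algebraicClasses_eq_top` holds: restricted ambient classes are
algebraic (`algebraicClasses_eq_top_of_surjective_map`, sibling file `HypersurfaceLefschetzProofs`)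
and the upper range follows from the lower one (`…_of_lower`).
[cite: VoisinHodgeII2003, §1.2.2 Thm. 1.23 and §1.2.3 Cor. 1.24–1.25 (PDF pp. 60–62)] -/
theorem Voisin2003_smoothHypersurface_algebraicClasses_eq_top_of_surjective_map
    (hHL : ∀ ⦃m : ℕ⦄ ⦃Y : Motives.SchemeOver ℂ⦄, nonempty_hardLefschetzNFold m Y)
    (hsurj : ∀ ⦃m d : ℕ⦄ ⦃Y : Motives.SchemeOver ℂ⦄, IsSmoothHypersurface m d Y →
      ∀ p : ℕ, 0 < p → 2 * p < m →
        ∃ (N : ℕ) (ι : Y ⟶ projectiveSpace N ℂ), Function.Surjective (complexBetti.map ι (2 * p))) :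
    Voisin2003_smoothHypersurface_algebraicClasses_eq_top :=
  Voisin2003_smoothHypersurface_algebraicClasses_eq_top_of_lower hHL fun _ _ _ hY p hp0 hpm ↦ by
    obtain ⟨N, ι, hι⟩ := hsurj hY p hp0 hpm
    exact algebraicClasses_eq_top_of_surjective_map hY.1 ι hι

end HodgeTheory

end Literature.AlgebraicGeometry.HodgeTheory
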